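import Summits.AtomisticToContinuum.BoseEinsteinCondensation.Theses.BECInfraredBound
import Literature.MathematicalPhysics.QuantumManyBody.BoseGasFreeDirichletBEC
import Literature.MathematicalPhysics.QuantumManyBody.CellProjectionTail
import Literature.MathematicalPhysics.QuantumManyBody.BoseGasWallCutoff
import Summits.AtomisticToContinuum.BoseEinsteinCondensation.Theorems.BECInfraredBoundBecUvTailKineticBudget
import Summits.AtomisticToContinuum.BoseEinsteinCondensation.Theorems.BECInfraredBoundBecUvTailOccupationWindow
import Summits.AtomisticToContinuum.BoseEinsteinCondensation.Theorems.BECInfraredBoundBecUvTailOneBodyTail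
import Summits.AtomisticToContinuum.BoseEinsteinCondensation.Theorems.BECInfraredBoundBecUvTailLiftOneBody
import Summits.AtomisticToContinuum.BoseEinsteinCondensation.Theorems.BECInfraredBoundBecUvTailTailArithmetic


/-!
# Crux `BecUvTail` (stmt-AtomisticToContinuum-8823) — line `Sketch` (lead's skeleton, CLOSED: every stub landed)

The SUMMED ULTRAVIOLET TAIL of the inner-box plane-wave occupations of Dirichlet δ-near-minimisers:
for every repulsive finite-range `v` there are `K > 0` and `θ < 1` such that for every
`ε ∈ (0,1/4)`, all small `ρ`, all large `N`, some `δ > 0` and every δ-near-minimiser `Ψ` in the box of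
side `L = (N/ρ)^{1/3}`, `Σ_{‖k‖∞ > K√ρ·L} ⟨φ'_k, γ_Ψ φ'_k⟩ ≤ θ N` (`φ'_k = L'^{-3/2}e^{2πik·x/L'}1_{Λ'}`,
`Λ' = (εL, L−εL)³`, `L' = (1−2ε)L`, sup norm on `k ∈ ℤ³`, `tsum` over the subtype in `ℝ≥0∞`).

## The line (birth's seam, collar mechanism for the analytic stub)

Birth (`Lines/birth.lean`) cut the crux into a KINETIC BUDGET (`T ≤ CρN` for near-minimisers; Dyson's
upper bound) and a `v`-free MOMENTUM-LOCALISATION statement (`T ≤ CρN ⇒ tail ≤ θN`). This skeleton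
keeps stub 1 verbatim and realises stub 2 through a ONE-BODY inequality on the cell `[0,ℓ)³` in the
clean "angle + kinetic" form
`ℓ³ Σ_{‖n‖∞ > K'} |ĉ_n(u)|² ≤ c₀ ∫_cell |u|² + A (ℓ/K')² ∫_cell |∇u|²`, `c₀ < 1`, all `C¹ u`, `K' ≥ M`,
(`stub_oneBodyTail`), lifted to `N` bodies slice by slice (`stub_occupationWindow` identifies the
crux's window occupations with `ℓ³|ĉ_k|²` of the translated slices; `stub_liftOneBody` integrates over
the spectators, Bose symmetry `T = N∫|∇₀Ψ|²`), and closed by arithmetic (`stub_tailArithmetic`: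
`K' = K√ρL ≥ M` eventually, `(ℓ/K')² T ≤ (C/K²) N`, `θ = (1+c₀)/2`).
The one-body inequality is proved (by the lead, from `stub_cutoff` + `stub_collarMass` + the tree's
support-Chebyshev `tsum_sq_grad_cellFourierCoeff_of_support` and Parseval `tsum_sq_cellFourierCoeff`)
by the COLLAR CUT-OFF: `u = χu + (1−χ)u` with a `C¹` product cut-off `χ` equal to `1` on the
`s`-shrunken cube and supported inside the cell, `s = ℓ/K'`, `|∇χ| ≤ 2π/s`; the tail of `χu` is paid by
the legal kinetic Chebyshev (`≤ (ℓ/2πK')² ∫|∇(χu)|²`), the whole of `(1−χ)u` by Parseval (collar mass),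
and the collar mass by the elementary one-body averaging inequality
`∫_{x_j<s} |u|² ≤ (2/M) ∫_cell |u|² + 2(M+1)s² ∫_cell |∂_j u|²` (mean value along lines + Cauchy–Schwarz),
giving `c₀ = O(1/M)` and `A = O(M)` — no boundary traces, no IBP of the state, no Dirichlet data.

Stubs (7): `stub_kineticBudget` (birth's stub 1, verbatim) · `stub_occupationWindow` · `stub_cutoff` ·
`stub_collarMass` · `stub_oneBodyTail` · `stub_liftOneBody` · `stub_tailArithmetic`.
Composition `BecUvTail_of` (real proof, pure logic) uses stubs 1, 2, 5, 6, 7; stubs 3, 4 are the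
registered ingredients of stub 5 (`stub_oneBodyTail`), which the lead discharges from them.
Registered-name aliases `__Registered.stub_X` as in `Lines/birth.lean` (the skeleton audit admits a
`Prop` hypothesis only by the head-constant name).
Disproof used: none on file (`ledger crux ls`: no `Disproof.lean`). Ideas used: `Ideas/collar-cutoff.md`
(window smoothing + support-Chebyshev), `Ideas/neumann-gram-angle.md` (the clean one-body form
`c₀·mass + A(ℓ/K')²·kinetic` and its `N`-body lift); birth's `stub_kineticBudget` and glue.
-/

namespace Summit.AtomisticToContinuum.BoseEinsteinCondensation.Cruxes.BecUvTail.Collar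

open MeasureTheory
open scoped ENNReal


/-! ### The stubs (all LANDED under `Theorems/BECInfraredBoundBecUvTail<Stub>.lean`; closing file `Theorems/BECInfraredBoundBecUvTail.lean`, theorem `BecUvTail_proof`) -/

/-- STUB 1 — A-PRIORI KINETIC BUDGET OF DIRICHLET δ-NEAR-MINIMISERS (birth's stub 1, verbatim; size M). For every repulsive finite-range `v` there are `C > 0`, `ρ₀ > 0` such that for `0 < ρ < ρ₀`, all large `N`, some `δ > 0` and every trial state `Ψ` in the box of side `(N/ρ)^{1/3}` with `energy v Ψ ≤ E₀ + δ`: `∫|∇Ψ|² ≤ CρN`. Plan: `∫ kineticDensity ≤ energy ≤ E₀ + δ`; `a(v) > 0`: `eventually_groundStateEnergy_le_dyson` (`a < ∞` by `scatteringLength_ne_top_of_finiteRange`), `ρ₀` so small that `C'(ρa³)^{1/3} ≤ 1`, giving `E₀ ≤ 8πaρN`; `a(v) = 0`: `exists_density_cap_tendsto_e0` + `e0_eq_zero_of_scatteringLength_zero` give `E₀/N → 0`, so `E₀ ≤ ρN` eventually; `δ := ofReal (ρN)`, `C := 8πa + 2`. [cite: LSSY2005, Thm 2.2 (2.14)–(2.15)]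 -/
theorem stub_kineticBudget :
    ∀ v : ℝ → ENNReal, Literature.MathematicalPhysics.QuantumManyBody.BoseGas.IsRepulsiveFiniteRange v → ∃ C : ℝ, 0 < C ∧ ∃ ρ₀ : ℝ, 0 < ρ₀ ∧ ∀ ρ : ℝ, 0 < ρ → ρ < ρ₀ → ∀ᶠ N : ℕ in Filter.atTop, ∃ δ : ENNReal, 0 < δ ∧ ∀ Ψ : Literature.MathematicalPhysics.QuantumManyBody.BoseGas.TrialState N (Literature.MathematicalPhysics.QuantumManyBody.BoseGas.sideLength ρ N), Literature.MathematicalPhysics.QuantumManyBody.BoseGas.energy v Ψ ≤ Literature.MathematicalPhysics.QuantumManyBody.BoseGas.groundStateEnergy v N (Literature.MathematicalPhysics.QuantumManyBody.BoseGas.sideLength ρ N) + δ → (∫⁻ X, Literature.MathematicalPhysics.QuantumManyBody.BoseGas.kineticDensity Ψ.ψ X) ≤ ENNReal.ofReal (C * ρ * N) :=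
  Summit.AtomisticToContinuum.BoseEinsteinCondensation.Theorems.BecUvTail.stub_kineticBudget

/-- STUB 2 — THE WINDOW OCCUPATIONS THROUGH CELL FOURIER COEFFICIENTS OF TRANSLATED SLICES (size M, pure bookkeeping). For `Ψ : (ℝ³)^{n+1} → ℂ`, `L > 0`, `ε ∈ (0,1/4)`, `k ∈ ℤ³`, with `ℓ = (1−2ε)L` and `a = (εL,εL,εL)`: `⟨φ'_k, γ_Ψ φ'_k⟩ = (n+1) ∫ dY ℓ³ |ĉ_k(x ↦ Ψ(x + a, Y))|²`, where `φ'_k = ℓ^{-3/2} e^{2πik·x/ℓ} 1_{(εL, L−εL)³}` is the crux's window mode and `ĉ_k = cellFourierCoeff ℓ` (`= ℓ⁻³∫_{[0,ℓ)³} conj(e_k) ·`). Steps: unfold `occupation (n+1)`; `conj(indicator · (c · exp)) * Ψ = indicator (conj c · conj exp · Ψ)`; `integral_indicator`; the open window `(εL, L−εL)³` and the half-open translate `a + [0,ℓ)³ = cellShift ℓ a` are a.e. equal (faces are null; cf. `boxIoc_ae_eq_cell`, `NeumannBox.box_ae_eq_cell`); `setIntegral_cell_comp_add`; `cellWave_apply`/`conj_cellWave`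 and `e_k(x + a) = e_k(x) e_k(a)` (`|e_k(a)| = 1`, `norm_cellWave`); `cellFourierCoeff_eq_integral`; `‖(√(ℓ³))⁻¹‖² ℓ⁶ = ℓ³`. No hypothesis on `Ψ` is needed (every step is an identity of integrals). [cite: LSSY2005, §1.2 (1.17)] -/
theorem stub_occupationWindow :
    ∀ (n : ℕ) (L ε : ℝ) (k : Fin 3 → ℤ) (Ψ : (Fin (n + 1) → EuclideanSpace ℝ (Fin 3)) → ℂ), 0 < L → 0 < ε → ε < 1 / 4 → Literature.MathematicalPhysics.QuantumManyBody.BoseGas.occupation (n + 1) ({x : EuclideanSpace ℝ (Fin 3) | ∀ j, x j ∈ Set.Ioo (ε * L) (L - ε * L)}.indicator fun x => ((Real.sqrt (((1 - 2 * ε) * L) ^ 3))⁻¹ : ℂ) * Complex.exp (Complex.I * ↑(2 * Real.pi / ((1 - 2 * ε) * L) * ∑ j, (k j : ℝ) * x j))) Ψ = (n + 1 : ENNReal) * ∫⁻ Y : Fin n → EuclideanSpace ℝ (Fin 3), ENNReal.ofReal ((1 - 2 * ε) * L) ^ 3 * (‖Literature.MathematicalPhysics.QuantumManyBody.BoseGas.cellFourierCoeff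 ((1 - 2 * ε) * L) (fun x => Ψ (Matrix.vecCons (x + (WithLp.toLp 2 (fun _ : Fin 3 => ε * L) : EuclideanSpace ℝ (Fin 3))) Y)) k‖₊ : ENNReal) ^ 2 :=
  Summit.AtomisticToContinuum.BoseEinsteinCondensation.Theorems.BecUvTail.stub_occupationWindow

/-- STUB 3 — THE `C¹` PRODUCT CUT-OFF OF THE CELL AT MARGIN `s` (size M). For `0 < s`, `4s ≤ ℓ` there is `χ : ℝ³ → [0,1]`, `C¹`, compactly supported with `tsupport χ ⊆ [0,ℓ)³`, `χ = 1` on the closed inner cube `{s ≤ x_j ≤ ℓ−s ∀j}`, `|∂_jχ| ≤ 2π/s` everywhere and `∂_jχ = 0` on the inner cube. Construction: `χ(x) = ∏_j θ(x_j)`, `θ = (1 − P₁)·P₂` with the wall profiles of `WallCutoff.exists_wallProfile` (`w = s/2`): `P₁ = 1` on `(−∞,s/2]`, `0` on `[s,∞)`; `P₂ = 1` on `(−∞,ℓ−s]`, `0` on `[ℓ−s/2,∞)`; so `θ ∈ [0,1]`, `θ = 0` off `(s/2, ℓ−s/2)`, `θ = 1` on `[s,ℓ−s]`, `|θ'| ≤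 2·π/(2w) = 2π/s`, `θ' = 0` on `[s, ℓ−s]` (the profiles' derivatives vanish off their ramps); `∂_jχ(x) = θ'(x_j)∏_{i≠j}θ(x_i)` (`HasFDerivAt.finset_prod` / `fderiv` of a product of functions of distinct coordinates, `EuclideanSpace.proj`); `tsupport χ ⊆ [s/2, ℓ−s/2]³` (closed, bounded ⇒ compact). [folklore] -/
theorem stub_cutoff :
    ∀ (ℓ s : ℝ), 0 < s → 4 * s ≤ ℓ → ∃ χ : EuclideanSpace ℝ (Fin 3) → ℝ, ContDiff ℝ 1 χ ∧ HasCompactSupport χ ∧ tsupport χ ⊆ Literature.MathematicalPhysics.QuantumManyBody.BoseGas.cell ℓ ∧ (∀ x, 0 ≤ χ x ∧ χ x ≤ 1) ∧ (∀ x : EuclideanSpace ℝ (Fin 3), (∀ j, x j ∈ Set.Icc s (ℓ - s)) → χ x = 1) ∧ (∀ (x : EuclideanSpace ℝ (Fin 3)) (j : Fin 3), |fderiv ℝ χ x (EuclideanSpace.single j 1)| ≤ 2 * Real.pi / s) ∧ (∀ x : EuclideanSpace ℝ (Fin 3), (∀ j, x j ∈ Set.Icc s (ℓ - s)) → ∀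 j : Fin 3, fderiv ℝ χ x (EuclideanSpace.single j 1) = 0) :=
  Summit.AtomisticToContinuum.BoseEinsteinCondensation.Theorems.BecUvTail.stub_cutoff

/-- STUB 4 — THE COLLAR MASS OF A `C¹` FUNCTION (one-body averaging inequality; size M/L). For `0 < s`, `1 ≤ M`, `(M+1)s ≤ ℓ` and `u ∈ C¹(ℝ³)`: `∫_{[0,ℓ)³ ∖ {s ≤ x_j ≤ ℓ−s ∀j}} |u|² ≤ (12/M)∫_{[0,ℓ)³}|u|² + 4(M+1)s² ∫_{[0,ℓ)³}|∇u|²`. Proof: the collar lies in the six slabs `{x ∈ cell | x_j < s}`, `{x ∈ cell | ℓ−s < x_j}`; on each line parallel to `e_j` with transverse coordinates in `[0,ℓ)²` the 1-D AVERAGING INEQUALITY `∫_{[0,s)}|f|² ≤ (2/M)∫_{[s,(M+1)s)}|f|² + 2(M+1)s²∫_{[0,(M+1)s)}|f'|²` holds for `f(t) = u(line(t))` (`|f(x)| ≤ |f(y)| + ∫_{[0,(M+1)s]}|f'|` by the FTC `intervalIntegral.integral_eq_sub_of_hasDerivAt`, square, average over `y ∈ [s,(M+1)s]`, integrate over `x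 ∈ [0,s)`, Cauchy–Schwarz `setLIntegral_sq_le_measure_mul`; mirror image for the far slab), and the line-by-line comparison is integrated over the transverse coordinates (Fubini on `ℝ³` singling out coordinate `j`: `lintegral_le_of_lmarginal_le {j}` after `PiLp.volume_preserving_toLp`, exactly as `lintegral_le_of_forall_line` of `BoseGasHardCoreContact` does for `Config N`; line derivative `hasDerivAt_lineSlice`); finally `Σ_j ∫|∂_ju|² = ∫ gradSqC u`. [folklore] -/
theorem stub_collarMass :
    ∀ (ℓ s M : ℝ), 0 < s → 1 ≤ M → (M + 1) * s ≤ ℓ → ∀ u : EuclideanSpace ℝ (Fin 3) → ℂ, ContDiff ℝ 1 u → ∫⁻ x in Literature.MathematicalPhysics.QuantumManyBody.BoseGas.cell ℓ \ {x : EuclideanSpace ℝ (Fin 3) | ∀ j, x j ∈ Set.Icc s (ℓ - s)}, (‖u x‖₊ : ENNReal) ^ 2 ≤ ENNReal.ofReal (12 / M) * (∫⁻ x in Literature.MathematicalPhysics.QuantumManyBody.BoseGas.cell ℓ, (‖u x‖₊ : ENNReal) ^ 2) + ENNReal.ofReal (4 * (M + 1) * s ^ 2) * ∫⁻ x in Literature.MathematicalPhysics.QuantumManyBody.BoseGas.cell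 ℓ, Literature.MathematicalPhysics.QuantumManyBody.BoseGas.gradSqC u x :=
  Summit.AtomisticToContinuum.BoseEinsteinCondensation.Theorems.BecUvTail.stub_collarMass

/-- STUB 5 — THE ONE-BODY ULTRAVIOLET TAIL INEQUALITY ON THE CELL (the load-bearing analytic statement; the LEAD proves it from stubs 3, 4 and the tree). There are `0 ≤ c₀ < 1`, `A ≥ 0`, `M ≥ 1` such that for every `ℓ > 0`, `K' ≥ M` and `u ∈ C¹(ℝ³)`: `ℓ³ Σ_{‖n‖∞ > K'} |ĉ_n(u)|² ≤ c₀ ∫_{[0,ℓ)³}|u|² + A(ℓ/K')² ∫_{[0,ℓ)³}|∇u|²` (`ĉ_n = cellFourierCoeff ℓ u n`, sup norm on `n`). Proof: `s := ℓ/K'`, `χ` from stub 3; `ĉ_n(u) = ĉ_n(χu) + ĉ_n((1−χ)u)` (linearity of the cell integral), `|a+b|² ≤ 2|a|²+2|b|²`; `ℓ³Σ_{‖n‖∞>K'}|ĉ_n(χu)|² ≤ (ℓ/2πK')²∫_cell|∇(χu)|²` (`‖n‖∞ > K' ⇒ Σn_j² > K'²` and `tsum_sq_grad_cellFourierCoeff_of_support`);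 `|∇(χu)|² ≤ 2|∇u|² + 2|∇χ|²|u|² ≤ 2|∇u|² + 24π²s⁻²·1_{collar}|u|²`; `ℓ³Σ_n|ĉ_n((1−χ)u)|² = ∫_cell|(1−χ)u|² ≤ ∫_{collar}|u|²` (`tsum_sq_cellFourierCoeff`); collar mass by stub 4: total `≤ 14·collar + (ℓ/K')²π⁻²∫|∇u|²`, `collar ≤ (12/M')mass + 4(M'+1)s²∫|∇u|²`, i.e. `c₀ = 168/M'`, `A = π⁻² + 56(M'+1)`, `M = max (M'+1) 4` with `M' = 336`. [folklore] -/
theorem stub_oneBodyTail :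
    ∃ c₀ : ℝ, 0 ≤ c₀ ∧ c₀ < 1 ∧ ∃ A : ℝ, 0 ≤ A ∧ ∃ M : ℝ, 1 ≤ M ∧ ∀ (ℓ K' : ℝ) (u : EuclideanSpace ℝ (Fin 3) → ℂ), 0 < ℓ → M ≤ K' → ContDiff ℝ 1 u → ENNReal.ofReal ℓ ^ 3 * ∑' n : {n : Fin 3 → ℤ // K' < ‖(fun j => (n j : ℝ))‖}, (‖Literature.MathematicalPhysics.QuantumManyBody.BoseGas.cellFourierCoeff ℓ u (n : Fin 3 → ℤ)‖₊ : ENNReal) ^ 2 ≤ ENNReal.ofReal c₀ * (∫⁻ x in Literature.MathematicalPhysics.QuantumManyBody.BoseGas.cell ℓ, (‖u x‖₊ : ENNReal) ^ 2) + ENNReal.ofReal (A * (ℓ / K') ^ 2) * ∫⁻ x in Literature.MathematicalPhysics.QuantumManyBody.BoseGas.cell ℓ, Literature.MathematicalPhysics.QuantumManyBody.BoseGas.gradSqC u x :=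
  Summit.AtomisticToContinuum.BoseEinsteinCondensation.Theorems.BecUvTail.stub_oneBodyTail

/-- STUB 6 — THE `N`-BODY LIFT OF A ONE-BODY TAIL INEQUALITY (size M/L; template `BoseGasFreeDirichletBEC.key_inequality`). If the one-body inequality of stub 5 holds with constants `c₀, A ≥ 0`, `M`, and the window identity of stub 2 holds, then for every Dirichlet trial state `Ψ` of `Λ_L^{n+1}`, `ε ∈ (0,1/4)`, `K' ≥ M`: `Σ_{‖k‖∞>K'} ⟨φ'_k, γ_Ψ φ'_k⟩ ≤ c₀ (n+1) + A((1−2ε)L/K')² ∫|∇Ψ|²`. Proof: rewrite each occupation by stub 2; `ENNReal.tsum_mul_left` and `lintegral_tsum` (measurability of `Y ↦ ‖ĉ_k(slice Y)‖₊²` as in `measurable_sliceSetIntegral_sq`: `StronglyMeasurable.integral_prod_right'`); for each `Y` apply the one-body inequality to `u_Y = x ↦ Ψ.ψ (vecCons (x + a) Y)` (`C¹`: `contDiff_vecCons_slice` ∘ translation); `∫_cell |u_Y|² = ∫_{cellShift ℓ a} |Ψ(·,Y)|² ≤ ∫ |Ψ(·,Y)|²` (`setLIntegral_cell_comp_add`)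 and `∫dY∫dx |Ψ(x,Y)|² = 1` (`lintegral_lintegral_swap`, `lintegral_lintegral_vecCons`, `Ψ.norm_eq`); `∫_cell gradSqC u_Y ≤ ∫ gradSqC (Ψ(·,Y))` (`gradSqC_comp_add`) and `(n+1)∫dY∫ gradSqC(Ψ(·,Y)) = ∫ kineticDensity Ψ` (`lintegral_partialGradSq_zero_eq`, `lintegral_kineticDensity_eq_mul` with `Ψ.symm`). [folklore] -/
theorem stub_liftOneBody :
    ∀ (c₀ A M : ℝ), 0 ≤ c₀ → 0 ≤ A → (∀ (ℓ K' : ℝ) (u : EuclideanSpace ℝ (Fin 3) → ℂ), 0 < ℓ → M ≤ K' → ContDiff ℝ 1 u → ENNReal.ofReal ℓ ^ 3 * ∑' n : {n : Fin 3 → ℤ // K' < ‖(fun j => (n j : ℝ))‖}, (‖Literature.MathematicalPhysics.QuantumManyBody.BoseGas.cellFourierCoeff ℓ u (n : Fin 3 → ℤ)‖₊ : ENNReal) ^ 2 ≤ ENNReal.ofReal c₀ * (∫⁻ x in Literature.MathematicalPhysics.QuantumManyBody.BoseGas.cell ℓ, (‖u x‖₊ : ENNReal) ^ 2) + ENNReal.ofReal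 (A * (ℓ / K') ^ 2) * ∫⁻ x in Literature.MathematicalPhysics.QuantumManyBody.BoseGas.cell ℓ, Literature.MathematicalPhysics.QuantumManyBody.BoseGas.gradSqC u x) → (∀ (n : ℕ) (L ε : ℝ) (k : Fin 3 → ℤ) (Ψ : (Fin (n + 1) → EuclideanSpace ℝ (Fin 3)) → ℂ), 0 < L → 0 < ε → ε < 1 / 4 → Literature.MathematicalPhysics.QuantumManyBody.BoseGas.occupation (n + 1) ({x : EuclideanSpace ℝ (Fin 3) | ∀ j, x j ∈ Set.Ioo (ε * L) (L - ε * L)}.indicator fun x => ((Real.sqrt (((1 - 2 * ε) * L) ^ 3))⁻¹ : ℂ) * Complex.exp (Complex.I * ↑(2 * Real.pi / ((1 - 2 * ε) * L) * ∑ j, (k j : ℝ) * x j))) Ψ = (n + 1 : ENNReal) * ∫⁻ Y : Fin n → EuclideanSpace ℝ (Fin 3), ENNReal.ofReal ((1 - 2 * ε) * L) ^ 3 * (‖Literature.MathematicalPhysics.QuantumManyBody.BoseGas.cellFourierCoeff ((1 - 2 * ε) * L) (fun x => Ψ (Matrix.vecCons (x + (WithLp.toLp 2 (fun _ : Fin 3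 => ε * L) : EuclideanSpace ℝ (Fin 3))) Y)) k‖₊ : ENNReal) ^ 2) → ∀ (n : ℕ) (L ε K' : ℝ) (Ψ : Literature.MathematicalPhysics.QuantumManyBody.BoseGas.TrialState (n + 1) L), 0 < L → 0 < ε → ε < 1 / 4 → M ≤ K' → ∑' k : {n : Fin 3 → ℤ // K' < ‖(fun j => (n j : ℝ))‖}, Literature.MathematicalPhysics.QuantumManyBody.BoseGas.occupation (n + 1) ({x : EuclideanSpace ℝ (Fin 3) | ∀ j, x j ∈ Set.Ioo (ε * L) (L - ε * L)}.indicator fun x => ((Real.sqrt (((1 - 2 * ε) * L) ^ 3))⁻¹ : ℂ) * Complex.exp (Complex.I * ↑(2 * Real.pi / ((1 - 2 * ε) * L) * ∑ j, ((k : Fin 3 → ℤ) j : ℝ) * x j))) Ψ.ψ ≤ ENNReal.ofReal c₀ * (n + 1 : ENNReal) + ENNReal.ofReal (A * ((1 - 2 * ε) * L / K') ^ 2) * ∫⁻ X, Literature.MathematicalPhysics.QuantumManyBody.BoseGas.kineticDensity Ψ.ψ X :=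
  Summit.AtomisticToContinuum.BoseEinsteinCondensation.Theorems.BecUvTail.stub_liftOneBody

/-- STUB 7 — ARITHMETIC: FROM THE LIFTED INEQUALITY TO BIRTH'S MOMENTUM-LOCALISATION STATEMENT (size M; reals, `ℝ≥0∞` casts and `Filter.atTop`). If for constants `0 ≤ c₀ < 1`, `A ≥ 0`, `M ≥ 1` the lifted bound of stub 6 holds, then for every `C > 0`, with `K := Real.sqrt (2AC/(1−c₀)) + 1` and `θ := (1+c₀)/2 < 1`: for every `ε ∈ (0,1/4)`, `ρ > 0`, eventually in `N` (namely `N ≥ 1` and `M ≤ K√ρ·(N/ρ)^{1/3}`, from `tendsto_sideLength_atTop`-type growth), every trial state with `∫|∇Ψ|² ≤ CρN` has tail `≤ c₀N + A((1−2ε)L/(K√ρL))²·CρN ≤ (c₀ + AC/K²)N ≤ θN` (`(1−2ε)² ≤ 1`, `L = sideLength ρ N > 0` cancels; write `N = n+1` to apply stub 6; `ENNReal.ofReal` algebra: `ofReal_mul`, `ofReal_le_ofReal`, `ENNReal.ofReal_natCast`-style casts of `(n+1 : ℝ≥0∞)`). [folklore] -/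
theorem stub_tailArithmetic :
    ∀ (c₀ A M : ℝ), 0 ≤ c₀ → c₀ < 1 → 0 ≤ A → 1 ≤ M → (∀ (n : ℕ) (L ε K' : ℝ) (Ψ : Literature.MathematicalPhysics.QuantumManyBody.BoseGas.TrialState (n + 1) L), 0 < L → 0 < ε → ε < 1 / 4 → M ≤ K' → ∑' k : {n : Fin 3 → ℤ // K' < ‖(fun j => (n j : ℝ))‖}, Literature.MathematicalPhysics.QuantumManyBody.BoseGas.occupation (n + 1) ({x : EuclideanSpace ℝ (Fin 3) | ∀ j, x j ∈ Set.Ioo (ε * L) (L - ε * L)}.indicator fun x => ((Real.sqrt (((1 - 2 * ε) * L) ^ 3))⁻¹ : ℂ) * Complex.exp (Complex.I * ↑(2 * Real.pi / ((1 - 2 * ε) * L) * ∑ j, ((k : Fin 3 → ℤ) j : ℝ) * x j))) Ψ.ψ ≤ ENNReal.ofReal c₀ * (n + 1 : ENNReal) + ENNReal.ofReal (A * ((1 - 2 * ε) * L / K') ^ 2) * ∫⁻ X, Literature.MathematicalPhysics.QuantumManyBody.BoseGas.kineticDensity Ψ.ψ X) → ∀ C : ℝ, 0 < C → ∃ K :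 ℝ, 0 < K ∧ ∃ θ : ℝ, θ < 1 ∧ ∀ ε : ℝ, 0 < ε → ε < 1 / 4 → ∀ ρ : ℝ, 0 < ρ → ∀ᶠ N : ℕ in Filter.atTop, ∀ Ψ : Literature.MathematicalPhysics.QuantumManyBody.BoseGas.TrialState N (Literature.MathematicalPhysics.QuantumManyBody.BoseGas.sideLength ρ N), (∫⁻ X, Literature.MathematicalPhysics.QuantumManyBody.BoseGas.kineticDensity Ψ.ψ X) ≤ ENNReal.ofReal (C * ρ * N) → ∑' k : {k : Fin 3 → ℤ // K * Real.sqrt ρ * Literature.MathematicalPhysics.QuantumManyBody.BoseGas.sideLength ρ N < ‖(fun j => (k j : ℝ))‖}, Literature.MathematicalPhysics.QuantumManyBody.BoseGas.occupation N ({x : EuclideanSpace ℝ (Fin 3) | ∀ j, x j ∈ Set.Ioo (ε * Literature.MathematicalPhysics.QuantumManyBody.BoseGas.sideLength ρ N) (Literature.MathematicalPhysics.QuantumManyBody.BoseGas.sideLength ρ N - ε * Literature.MathematicalPhysics.QuantumManyBody.BoseGas.sideLength ρ N)}.indicator fun x => ((Real.sqrt (((1 - 2 * ε) * Literature.MathematicalPhysics.QuantumManyBody.BoseGas.sideLength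 ρ N) ^ 3))⁻¹ : ℂ) * Complex.exp (Complex.I * ↑(2 * Real.pi / ((1 - 2 * ε) * Literature.MathematicalPhysics.QuantumManyBody.BoseGas.sideLength ρ N) * ∑ j, ((k : Fin 3 → ℤ) j : ℝ) * x j))) Ψ.ψ ≤ ENNReal.ofReal (θ * N) :=
  Summit.AtomisticToContinuum.BoseEinsteinCondensation.Theorems.BecUvTail.stub_tailArithmetic


/-! ### Registered-name aliases of the stub statements

The native skeleton audit (`#h21_check_skeleton`, run by `ledger skeleton check`) admits a `Prop`
hypothesis of the skeleton theorem only if its HEAD CONSTANT is a registered obligation or is NAMED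
like a declared stub. A verbatim `∀ …` signature has no head constant, so the stubs used by the
composition enter `BecUvTail_of` through the aliases below: `__Registered.stub_X` is the statement of
`stub_X`, character for character, under that name (reducible, definitionally equal). The `__`
namespace is an implementation detail skipped by the audit's declaration scan, so the registered
stubs remain the sorried THEOREMS `stub_X` (device of `Lines/birth.lean`). -/
namespace __Registered

/-- The statement of `stub_kineticBudget`, verbatim, keyed by the registered stub name. -/
abbrev stub_kineticBudget : Prop :=
    ∀ v : ℝ → ENNReal, Literature.MathematicalPhysics.QuantumManyBody.BoseGas.IsRepulsiveFiniteRange v → ∃ C : ℝ, 0 < C ∧ ∃ ρ₀ : ℝ, 0 < ρ₀ ∧ ∀ ρ : ℝ, 0 < ρ → ρ < ρ₀ → ∀ᶠ N : ℕ in Filter.atTop, ∃ δ : ENNReal, 0 < δ ∧ ∀ Ψ : Literature.MathematicalPhysics.QuantumManyBody.BoseGas.TrialState N (Literature.MathematicalPhysics.QuantumManyBody.BoseGas.sideLength ρ N), Literature.MathematicalPhysics.QuantumManyBody.BoseGas.energy v Ψ ≤ Literature.MathematicalPhysics.QuantumManyBody.BoseGas.groundStateEnergy v N (Literature.MathematicalPhysics.QuantumManyBody.BoseGas.sideLength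 ρ N) + δ → (∫⁻ X, Literature.MathematicalPhysics.QuantumManyBody.BoseGas.kineticDensity Ψ.ψ X) ≤ ENNReal.ofReal (C * ρ * N)

/-- The statement of `stub_occupationWindow`, verbatim, keyed by the registered stub name. -/
abbrev stub_occupationWindow : Prop :=
    ∀ (n : ℕ) (L ε : ℝ) (k : Fin 3 → ℤ) (Ψ : (Fin (n + 1) → EuclideanSpace ℝ (Fin 3)) → ℂ), 0 < L → 0 < ε → ε < 1 / 4 → Literature.MathematicalPhysics.QuantumManyBody.BoseGas.occupation (n + 1) ({x : EuclideanSpace ℝ (Fin 3) | ∀ j, x j ∈ Set.Ioo (ε * L) (L - ε * L)}.indicator fun x => ((Real.sqrt (((1 - 2 * ε) * L) ^ 3))⁻¹ : ℂ) * Complex.exp (Complex.I * ↑(2 * Real.pi / ((1 - 2 * ε) * L) * ∑ j, (k j : ℝ) * x j))) Ψ = (n + 1 : ENNReal) * ∫⁻ Y : Fin n → EuclideanSpace ℝ (Fin 3), ENNReal.ofReal ((1 - 2 * ε) * L) ^ 3 * (‖Literature.MathematicalPhysics.QuantumManyBody.BoseGas.cellFourierCoeff ((1 - 2 * ε) * L)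 (fun x => Ψ (Matrix.vecCons (x + (WithLp.toLp 2 (fun _ : Fin 3 => ε * L) : EuclideanSpace ℝ (Fin 3))) Y)) k‖₊ : ENNReal) ^ 2

/-- The statement of `stub_oneBodyTail`, verbatim, keyed by the registered stub name. -/
abbrev stub_oneBodyTail : Prop :=
    ∃ c₀ : ℝ, 0 ≤ c₀ ∧ c₀ < 1 ∧ ∃ A : ℝ, 0 ≤ A ∧ ∃ M : ℝ, 1 ≤ M ∧ ∀ (ℓ K' : ℝ) (u : EuclideanSpace ℝ (Fin 3) → ℂ), 0 < ℓ → M ≤ K' → ContDiff ℝ 1 u → ENNReal.ofReal ℓ ^ 3 * ∑' n : {n : Fin 3 → ℤ // K' < ‖(fun j => (n j : ℝ))‖}, (‖Literature.MathematicalPhysics.QuantumManyBody.BoseGas.cellFourierCoeff ℓ u (n : Fin 3 → ℤ)‖₊ : ENNReal) ^ 2 ≤ ENNReal.ofReal c₀ * (∫⁻ x in Literature.MathematicalPhysics.QuantumManyBody.BoseGas.cell ℓ, (‖u x‖₊ : ENNReal) ^ 2) + ENNReal.ofReal (A * (ℓ / K') ^ 2) * ∫⁻ x in Literature.MathematicalPhysics.QuantumManyBody.BoseGas.cell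 ℓ, Literature.MathematicalPhysics.QuantumManyBody.BoseGas.gradSqC u x

/-- The statement of `stub_liftOneBody`, verbatim, keyed by the registered stub name. -/
abbrev stub_liftOneBody : Prop :=
    ∀ (c₀ A M : ℝ), 0 ≤ c₀ → 0 ≤ A → (∀ (ℓ K' : ℝ) (u : EuclideanSpace ℝ (Fin 3) → ℂ), 0 < ℓ → M ≤ K' → ContDiff ℝ 1 u → ENNReal.ofReal ℓ ^ 3 * ∑' n : {n : Fin 3 → ℤ // K' < ‖(fun j => (n j : ℝ))‖}, (‖Literature.MathematicalPhysics.QuantumManyBody.BoseGas.cellFourierCoeff ℓ u (n : Fin 3 → ℤ)‖₊ : ENNReal) ^ 2 ≤ ENNReal.ofReal c₀ * (∫⁻ x in Literature.MathematicalPhysics.QuantumManyBody.BoseGas.cell ℓ, (‖u x‖₊ : ENNReal) ^ 2) + ENNReal.ofReal (A * (ℓ / K') ^ 2) * ∫⁻ x in Literature.MathematicalPhysics.QuantumManyBody.BoseGas.cell ℓ, Literature.MathematicalPhysics.QuantumManyBody.BoseGas.gradSqC u x) → (∀ (n : ℕ) (L ε : ℝ) (k : Fin 3 → ℤ) (Ψ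 : (Fin (n + 1) → EuclideanSpace ℝ (Fin 3)) → ℂ), 0 < L → 0 < ε → ε < 1 / 4 → Literature.MathematicalPhysics.QuantumManyBody.BoseGas.occupation (n + 1) ({x : EuclideanSpace ℝ (Fin 3) | ∀ j, x j ∈ Set.Ioo (ε * L) (L - ε * L)}.indicator fun x => ((Real.sqrt (((1 - 2 * ε) * L) ^ 3))⁻¹ : ℂ) * Complex.exp (Complex.I * ↑(2 * Real.pi / ((1 - 2 * ε) * L) * ∑ j, (k j : ℝ) * x j))) Ψ = (n + 1 : ENNReal) * ∫⁻ Y : Fin n → EuclideanSpace ℝ (Fin 3), ENNReal.ofReal ((1 - 2 * ε) * L) ^ 3 * (‖Literature.MathematicalPhysics.QuantumManyBody.BoseGas.cellFourierCoeff ((1 - 2 * ε) * L) (fun x => Ψ (Matrix.vecCons (x + (WithLp.toLp 2 (fun _ : Fin 3 => ε * L) : EuclideanSpace ℝ (Fin 3))) Y)) k‖₊ : ENNReal) ^ 2) → ∀ (n : ℕ) (L ε K' : ℝ) (Ψ : Literature.MathematicalPhysics.QuantumManyBody.BoseGas.TrialState (n + 1) L), 0 < L → 0 < ε → ε < 1 /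 4 → M ≤ K' → ∑' k : {n : Fin 3 → ℤ // K' < ‖(fun j => (n j : ℝ))‖}, Literature.MathematicalPhysics.QuantumManyBody.BoseGas.occupation (n + 1) ({x : EuclideanSpace ℝ (Fin 3) | ∀ j, x j ∈ Set.Ioo (ε * L) (L - ε * L)}.indicator fun x => ((Real.sqrt (((1 - 2 * ε) * L) ^ 3))⁻¹ : ℂ) * Complex.exp (Complex.I * ↑(2 * Real.pi / ((1 - 2 * ε) * L) * ∑ j, ((k : Fin 3 → ℤ) j : ℝ) * x j))) Ψ.ψ ≤ ENNReal.ofReal c₀ * (n + 1 : ENNReal) + ENNReal.ofReal (A * ((1 - 2 * ε) * L / K') ^ 2) * ∫⁻ X, Literature.MathematicalPhysics.QuantumManyBody.BoseGas.kineticDensity Ψ.ψ X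

/-- The statement of `stub_tailArithmetic`, verbatim, keyed by the registered stub name. -/
abbrev stub_tailArithmetic : Prop :=
    ∀ (c₀ A M : ℝ), 0 ≤ c₀ → c₀ < 1 → 0 ≤ A → 1 ≤ M → (∀ (n : ℕ) (L ε K' : ℝ) (Ψ : Literature.MathematicalPhysics.QuantumManyBody.BoseGas.TrialState (n + 1) L), 0 < L → 0 < ε → ε < 1 / 4 → M ≤ K' → ∑' k : {n : Fin 3 → ℤ // K' < ‖(fun j => (n j : ℝ))‖}, Literature.MathematicalPhysics.QuantumManyBody.BoseGas.occupation (n + 1) ({x : EuclideanSpace ℝ (Fin 3) | ∀ j, x j ∈ Set.Ioo (ε * L) (L - ε * L)}.indicator fun x => ((Real.sqrt (((1 - 2 * ε) * L) ^ 3))⁻¹ : ℂ) * Complex.exp (Complex.I * ↑(2 * Real.pi / ((1 - 2 * ε) * L) * ∑ j, ((k : Fin 3 → ℤ) j : ℝ) * x j))) Ψ.ψ ≤ ENNReal.ofReal c₀ * (n + 1 : ENNReal) + ENNReal.ofReal (A * ((1 - 2 * ε) * L / K') ^ 2) * ∫⁻ X, Literature.MathematicalPhysics.QuantumManyBody.BoseGas.kineticDensity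 Ψ.ψ X) → ∀ C : ℝ, 0 < C → ∃ K : ℝ, 0 < K ∧ ∃ θ : ℝ, θ < 1 ∧ ∀ ε : ℝ, 0 < ε → ε < 1 / 4 → ∀ ρ : ℝ, 0 < ρ → ∀ᶠ N : ℕ in Filter.atTop, ∀ Ψ : Literature.MathematicalPhysics.QuantumManyBody.BoseGas.TrialState N (Literature.MathematicalPhysics.QuantumManyBody.BoseGas.sideLength ρ N), (∫⁻ X, Literature.MathematicalPhysics.QuantumManyBody.BoseGas.kineticDensity Ψ.ψ X) ≤ ENNReal.ofReal (C * ρ * N) → ∑' k : {k : Fin 3 → ℤ // K * Real.sqrt ρ * Literature.MathematicalPhysics.QuantumManyBody.BoseGas.sideLength ρ N < ‖(fun j => (k j : ℝ))‖}, Literature.MathematicalPhysics.QuantumManyBody.BoseGas.occupation N ({x : EuclideanSpace ℝ (Fin 3) | ∀ j, x j ∈ Set.Ioo (ε * Literature.MathematicalPhysics.QuantumManyBody.BoseGas.sideLength ρ N) (Literature.MathematicalPhysics.QuantumManyBody.BoseGas.sideLength ρ N - ε * Literature.MathematicalPhysics.QuantumManyBody.BoseGas.sideLength ρ N)}.indicator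 fun x => ((Real.sqrt (((1 - 2 * ε) * Literature.MathematicalPhysics.QuantumManyBody.BoseGas.sideLength ρ N) ^ 3))⁻¹ : ℂ) * Complex.exp (Complex.I * ↑(2 * Real.pi / ((1 - 2 * ε) * Literature.MathematicalPhysics.QuantumManyBody.BoseGas.sideLength ρ N) * ∑ j, ((k : Fin 3 → ℤ) j : ℝ) * x j))) Ψ.ψ ≤ ENNReal.ofReal (θ * N)

end __Registered


/-! ### The assembly -/

/-- THE SKELETON THEOREM, HYPOTHESIS FORM (real proof, no `sorry`; pure logic): the statements of
stubs 1 (kinetic budget), 2 (window identity), 5 (one-body tail), 6 (lift) and 7 (arithmetic) — each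
under its REGISTERED NAME — imply the crux `BECInfraredBound.BecUvTail` BY NAME. Bookkeeping: stub 5
yields `c₀, A, M`; stub 6 fed with stubs 5 and 2 yields the lifted bound; stub 7 turns it into birth's
momentum-localisation statement `∀ C > 0, ∃ K θ …`; then birth's glue: the budget constant `C` of stub 1
is fed in, `ρ₀ :=` stub 1's, the two `∀ᶠ N` eventualities are intersected, `δ :=` stub 1's.
Stubs 3 and 4 (`stub_cutoff`, `stub_collarMass`) are the registered ingredients of stub 5 and enter
through its proof. [folklore] -/
theorem BecUvTail_of :
    __Registered.stub_kineticBudget →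
    __Registered.stub_occupationWindow →
    __Registered.stub_oneBodyTail →
    __Registered.stub_liftOneBody →
    __Registered.stub_tailArithmetic →
    Summit.AtomisticToContinuum.BoseEinsteinCondensation.Theses.BECInfraredBound.BecUvTail := by
  intro h1 hB hG hF1 hF2 v hv
  obtain ⟨C, hC, ρ₀, hρ₀, H1⟩ := h1 v hv
  obtain ⟨c₀, hc₀, hc₁, A, hA, M, hM, hOne⟩ := hG
  obtain ⟨K, hK, θ, hθ, H2⟩ :=
    hF2 c₀ A M hc₀ hc₁ hA hM (hF1 c₀ A M hc₀ hA hOne hB) C hC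
  refine ⟨K, hK, θ, hθ, fun ε hε hε4 => ⟨ρ₀, hρ₀, fun ρ hρ hρρ₀ => ?_⟩⟩
  filter_upwards [H1 ρ hρ hρρ₀, H2 ε hε hε4 ρ hρ] with N hN1 hN2
  obtain ⟨δ, hδ, hΨ⟩ := hN1
  exact ⟨δ, hδ, fun Ψ hE => hN2 Ψ (hΨ Ψ hE)⟩

/-- THE SKELETON THEOREM, CLOSED FORM: the crux `BECInfraredBound.BecUvTail` from the declared stubs
(no `sorry` remains — every stub is the landed theorem `Theorems.BecUvTail.stub_X`; the composition is `BecUvTail_of`). [folklore] -/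
theorem BecUvTail_of_stubs :
    Summit.AtomisticToContinuum.BoseEinsteinCondensation.Theses.BECInfraredBound.BecUvTail :=
  BecUvTail_of stub_kineticBudget stub_occupationWindow stub_oneBodyTail stub_liftOneBody
    stub_tailArithmetic

end Summit.AtomisticToContinuum.BoseEinsteinCondensation.Cruxes.BecUvTail.Collar
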